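import Literature.AlgebraicGeometry.ModuliOfAbelianVarieties.SiegelAdelicMarkingHomKernel
import HarnessLib

/-!
# Stable lines through a marking: subgroups of `A(ℂ)` between `u(Λ_a)` and `u(L_max)` are the `u(L)`, `Λ_a ≤ L ≤ L_max`

Topic `AlgebraicGeometry/ModuliOfAbelianVarieties`; namespace `Literature.AlgebraicGeometry.ModuliOfAbelianVarieties.SiegelAdelicMarking`.
THEOREMS ONLY (no definition, no named fact, no instance, no notation, no `sorry`).  Cell `hodgecm-mathlib` (D-0151), FLOOR 0, P6 «MOD programme»
(crux hLiu418 = stmt-HodgeConjecture-24832, `--supports`, count-neutral), EHECKE closer organ (O-R1) «lines half of the E-side Hecke roofs at complex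
points», generic part (R1-α); HC_CM is proved only modulo the printed citations until rung 0 closes.

SETTING ([Milne2005ShimuraVarieties] §6 Thm. 6.11 p. 74 and p. 75; [MumfordAV1970] §7 Thm. 4 p. 72): `A` a complex abelian variety marked by `[J, a]`
(★ `SiegelAdelicMarking`; torsion parametrisation `u = m.r : V = ℚ^{2g} → A(ℂ)`, a homomorphism with kernel `Λ_a = latticeOfGL a`, ★
`r_eq_one_iff_mem_latticeOfGL`), endomorphisms `ι b` (`b : R`) READING rational matrices `M b` on the marking (`ι b (u v) = u (M b v)`), and an «ideal»
`𝔞 ⊆ R` one of whose elements reads an invertible matrix.  The LATTICE CORRESPONDENCE through `u`: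

* §1 `image_r_eq_image_r_iff` — `u(L) = u(L′) ↔ L = L′` for `ℤ`-submodules `L, L′ ⊇ Λ_a`; `forall_mulVec_mem_of_forall_map_mem_image_r` — `u(L)` is
  `ι b`-stable iff `L` is `M b`-stable (with ★ `map_mem_image_r_of_forall_mulVec_mem`); `exists_submodule_image_r_eq` — every subgroup `H ⊆ u(L_max)`
  of `A(ℂ)` is `u(L)` for an `L` with `Λ_a ≤ L ≤ L_max` (`L = u⁻¹(H) ∩ L_max`).
* §2 `forall_map_eq_one_iff_exists_r_eq` — the `𝔞`-torsion `A[𝔞] = {P | ι b P = 1 ∀ b ∈ 𝔞}` is `u(𝔞⁻¹Λ_a)`, `𝔞⁻¹Λ_a := {v | M b v ∈ Λ_a ∀ b ∈ 𝔞}`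
  (★ `forall_map_eq_one_and_forall_iff`).
* §3 HEAD `exists_stableLines` — **a family of lattices `i ↦ H i` with `Λ_a ≤ H i ≤ 𝔞⁻¹Λ_a`, injective, of index `n`, `M`-stable, and EXHAUSTIVE among
  the `M`-stable index-`n` lattices between `Λ_a` and `𝔞⁻¹Λ_a`, gives subgroups `H_i := u(H i)` of `A(ℂ)`: injective in `i`, of order `n`, inside `A[𝔞]`,
  `ι`-stable, and EXHAUSTIVE among the `ι`-stable order-`n` subgroups of `A[𝔞]`** — conjuncts (1)(2)(3) of the E-side `HeckeLinesRoofsAt` with the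
  lattice statements (the Hecke-neighbour counts (L-c)(L-c′)) as hypotheses.

## References
* [Milne2005ShimuraVarieties] J. S. Milne, *Introduction to Shimura varieties* (2005), §6 Thm. 6.11 p. 74 and p. 75 («`aK ↦ ηK`»; `V/Λ ≅ V(𝔸_f)/Λ̂`).
* [MumfordAV1970] D. Mumford, *Abelian Varieties* (1970), §7 Thm. 4 (p. 72) (finite subgroups ↔ lattices containing `Λ`), §23 p. 231.
* [ShimuraIATAF1971] G. Shimura, *Introduction to the Arithmetic Theory of Automorphic Functions* (1971), §3.2 (the `q + 1` neighbours), §7.3.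

#harness_tags algebraic_geometry.abelian_varieties, number_theory.shimura_varieties
-/

set_option autoImplicit false

noncomputable section

open CategoryTheory AlgebraicGeometry Matrix
open Literature.AlgebraicGeometry.Motives (SchemeOver ComplexPoints AlgPoints specOver AbelianVariety)
open Literature.NumberTheory.Adeles (latticeOfGL)

namespace Literature.AlgebraicGeometry.ModuliOfAbelianVarieties

namespace SiegelAdelicMarking

variable {g : ℕ} {δ : Fin g → ℕ} {J : C0pm δ} {a : gspFinAdelic δ} {A : AbelianVariety ℂ}

/-! ### §1 The lattice correspondence through the torsion parametrisation `u` -/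

/-- `u(−v) = u(v)⁻¹`. [cite: Milne2005ShimuraVarieties, §6 Thm. 6.11 p. 74] -/
theorem r_neg (m : SiegelAdelicMarking J a A) (v : Fin g ⊕ Fin g → ℚ) : m.r (-v) = (m.r v)⁻¹ :=
  eq_inv_of_mul_eq_one_left (by rw [← m.r_add, neg_add_cancel, m.r_zero])

/-- **`u(L) = u(L′) ↔ L = L′`** for `ℤ`-submodules containing `Λ_a = ker u`. [cite: Milne2005ShimuraVarieties, §6 Thm. 6.11 p. 74 and p. 75]
[cite: MumfordAV1970, §7 Thm. 4 (p. 72)] -/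
theorem image_r_eq_image_r_iff (m : SiegelAdelicMarking J a A) {L L' : Submodule ℤ (Fin g ⊕ Fin g → ℚ)}
    (hL : latticeOfGL (a : GL (Fin g ⊕ Fin g) finAdeleQ) ≤ L) (hL' : latticeOfGL (a : GL (Fin g ⊕ Fin g) finAdeleQ) ≤ L') :
    m.r '' (L : Set (Fin g ⊕ Fin g → ℚ)) = m.r '' (L' : Set (Fin g ⊕ Fin g → ℚ)) ↔ L = L' := by
  refine ⟨fun h => ?_, fun h => by rw [h]⟩
  ext v
  rw [← m.mem_image_r_iff hL v, h, m.mem_image_r_iff hL' v]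

/-- **If `u(L)` is stable under an endomorphism `ι` reading `M`, then `L ⊇ Λ_a` is `M`-stable** (converse of ★ `map_mem_image_r_of_forall_mulVec_mem`).
[cite: Milne2005ShimuraVarieties, §6 Thm. 6.11 p. 74] -/
theorem forall_mulVec_mem_of_forall_map_mem_image_r (m : SiegelAdelicMarking J a A) {L : Submodule ℤ (Fin g ⊕ Fin g → ℚ)}
    (hL : latticeOfGL (a : GL (Fin g ⊕ Fin g) finAdeleQ) ≤ L) (ι : A ⟶ A) (M : Matrix (Fin g ⊕ Fin g) (Fin g ⊕ Fin g) ℚ)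
    (hι : ∀ v : Fin g ⊕ Fin g → ℚ, AlgPoints.map ι.hom.hom.hom (m.r v) = m.r (M *ᵥ v))
    (h : ∀ P ∈ m.r '' (L : Set (Fin g ⊕ Fin g → ℚ)), AlgPoints.map ι.hom.hom.hom P ∈ m.r '' (L : Set (Fin g ⊕ Fin g → ℚ))) :
    ∀ v ∈ L, M *ᵥ v ∈ L := by
  intro v hv
  have h1 := h (m.r v) ⟨v, hv, rfl⟩
  rw [hι] at h1
  exact (m.mem_image_r_iff hL _).1 h1

/-- **Every subgroup `H ⊆ u(L_max)` of `A(ℂ)` is `u(L)` for a `ℤ`-submodule `Λ_a ≤ L ≤ L_max`** (`L := u⁻¹(H) ∩ L_max`; finite subgroups of a complex torus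
are lattices containing the period lattice). [cite: MumfordAV1970, §7 Thm. 4 (p. 72)] [cite: Milne2005ShimuraVarieties, §6 Thm. 6.11 p. 74 and p. 75] -/
theorem exists_submodule_image_r_eq (m : SiegelAdelicMarking J a A) {Lmax : Submodule ℤ (Fin g ⊕ Fin g → ℚ)}
    (hΛ : latticeOfGL (a : GL (Fin g ⊕ Fin g) finAdeleQ) ≤ Lmax) (H : Subgroup (A.Points ℂ))
    (hH : (H : Set (A.Points ℂ)) ⊆ m.r '' (Lmax : Set (Fin g ⊕ Fin g → ℚ))) :
    ∃ L : Submodule ℤ (Fin g ⊕ Fin g → ℚ), latticeOfGL (a : GL (Fin g ⊕ Fin g) finAdeleQ) ≤ L ∧ L ≤ Lmax ∧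
      m.r '' (L : Set (Fin g ⊕ Fin g → ℚ)) = H := by
  -- `u` as an additive homomorphism into `A(ℂ)` written additively
  let f : (Fin g ⊕ Fin g → ℚ) →+ Additive (A.Points ℂ) :=
    { toFun := fun v => Additive.ofMul (m.r v)
      map_zero' := by rw [m.r_zero]; rfl
      map_add' := fun v w => by rw [m.r_add]; rfl }
  have hf : ∀ v, f v = Additive.ofMul (m.r v) := fun _ => rfl
  let L : Submodule ℤ (Fin g ⊕ Fin g → ℚ) := AddSubgroup.toIntSubmodule ((Subgroup.toAddSubgroup H).comap f) ⊓ Lmax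
  have hmem : ∀ v, v ∈ L ↔ m.r v ∈ H ∧ v ∈ Lmax := fun v => by
    change v ∈ AddSubgroup.toIntSubmodule ((Subgroup.toAddSubgroup H).comap f) ⊓ Lmax ↔ _
    rw [Submodule.mem_inf]
    exact Iff.rfl
  refine ⟨L, fun v hv => (hmem v).2 ⟨by rw [(m.r_eq_one_iff_mem_latticeOfGL v).2 hv]; exact H.one_mem, hΛ hv⟩,
    fun v hv => ((hmem v).1 hv).2, Set.Subset.antisymm ?_ fun P hP => ?_⟩
  · rintro _ ⟨v, hv, rfl⟩
    exact ((hmem v).1 hv).1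
  · obtain ⟨v, hv, rfl⟩ := hH hP
    exact ⟨v, (hmem v).2 ⟨hP, hv⟩, rfl⟩

/-! ### §2 The `𝔞`-torsion read on the lattice side -/

/-- **`(∀ b ∈ 𝔞, ι b P = 1) ↔ ∃ v, u v = P ∧ ∀ b ∈ 𝔞, M b v ∈ Λ_a`** — the `𝔞`-torsion of `A(ℂ)` for a family of endomorphisms `ι b` reading matrices `M b`,
one of which (`b₀ ∈ 𝔞`) is invertible over `ℚ` (★ `forall_map_eq_one_and_forall_iff` with both families equal to `ι|_𝔞`).
[cite: Milne2005ShimuraVarieties, §6 Thm. 6.11 p. 74 and p. 75] [cite: MumfordAV1970, §7 Thm. 4 (p. 72)] -/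
theorem forall_map_eq_one_iff_exists_r_eq (m : SiegelAdelicMarking J a A)
    {R : Type*} (𝔞 : Set R) (ι : R → (A ⟶ A)) (M : R → Matrix (Fin g ⊕ Fin g) (Fin g ⊕ Fin g) ℚ)
    (hι : ∀ b ∈ 𝔞, ∀ v : Fin g ⊕ Fin g → ℚ, AlgPoints.map (ι b).hom.hom.hom (m.r v) = m.r (M b *ᵥ v))
    {b₀ : R} (hb₀ : b₀ ∈ 𝔞) (q₀ : GL (Fin g ⊕ Fin g) ℚ)
    (hq₀ : ((q₀ : GL (Fin g ⊕ Fin g) ℚ) : Matrix (Fin g ⊕ Fin g) (Fin g ⊕ Fin g) ℚ) = M b₀) (P : A.Points ℂ) :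
    (∀ b ∈ 𝔞, AlgPoints.map (ι b).hom.hom.hom P = 1) ↔
      ∃ v : Fin g ⊕ Fin g → ℚ, m.r v = P ∧ ∀ b ∈ 𝔞, M b *ᵥ v ∈ latticeOfGL (a : GL (Fin g ⊕ Fin g) finAdeleQ) := by
  have h := m.forall_map_eq_one_and_forall_iff m 𝔞 ι M hι hb₀ q₀ hq₀ 𝔞 ι M hι P
  constructor
  · intro hP
    obtain ⟨v, hv, h1, -⟩ := h.1 ⟨hP, hP⟩
    exact ⟨v, hv, h1⟩
  · rintro ⟨v, hv, h1⟩
    exact (h.2 ⟨v, hv, h1, h1⟩).1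

/-! ### §3 Stable lines -/

/-- **STABLE LINES THROUGH A MARKING.**  Let endomorphisms `ι b` (`b : R`) of the marked complex abelian variety `A` read matrices `M b` on the marking
(`ι b (u v) = u (M b v)`), and let `𝔞 ⊆ R` contain some `b₀` with `M b₀` invertible.  Suppose `i ↦ H i` is an INJECTIVE family of `ℤ`-lattices with
`Λ_a ≤ H i`, `M(𝔞) H i ⊆ Λ_a` (i.e. `H i ⊆ 𝔞⁻¹Λ_a`), of index `[H i : Λ_a] = n`, `M`-stable, and such that EVERY `M`-stable `L` with `Λ_a ≤ L ⊆ 𝔞⁻¹Λ_a`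
of index `n` is some `H i`.  Then the subgroups `H_i := u(H i)` of `A(ℂ)` are: given by the reader `P ∈ H_i ↔ P ∈ u(H i)`; injective in `i`; of order `n`;
contained in the `𝔞`-torsion; `ι`-stable; and EVERY `ι`-stable subgroup of order `n` of the `𝔞`-torsion is some `H_i` — conjuncts (1)(2)(3) of the
E-side Hecke roofs («the `q + 1` lines of `A[𝔭]` are the Hecke neighbours»), lattice statements in, point statements out.
[cite: ShimuraIATAF1971, §3.2, §7.3] [cite: Milne2005ShimuraVarieties, §6 Thm. 6.11 p. 74 and p. 75] [cite: MumfordAV1970, §7 Thm. 4 (p. 72), §23 p. 231] -/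
theorem exists_stableLines (m : SiegelAdelicMarking J a A)
    {R : Type*} (ι : R → (A ⟶ A)) (M : R → Matrix (Fin g ⊕ Fin g) (Fin g ⊕ Fin g) ℚ)
    (hι : ∀ b (v : Fin g ⊕ Fin g → ℚ), AlgPoints.map (ι b).hom.hom.hom (m.r v) = m.r (M b *ᵥ v))
    (𝔞 : Set R) {b₀ : R} (hb₀ : b₀ ∈ 𝔞) (q₀ : GL (Fin g ⊕ Fin g) ℚ)
    (hq₀ : ((q₀ : GL (Fin g ⊕ Fin g) ℚ) : Matrix (Fin g ⊕ Fin g) (Fin g ⊕ Fin g) ℚ) = M b₀)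
    {β : Type*} (H : β → Submodule ℤ (Fin g ⊕ Fin g → ℚ)) (n : ℕ)
    (hΛ : ∀ i, latticeOfGL (a : GL (Fin g ⊕ Fin g) finAdeleQ) ≤ H i)
    (h𝔞 : ∀ i, ∀ v ∈ H i, ∀ b ∈ 𝔞, M b *ᵥ v ∈ latticeOfGL (a : GL (Fin g ⊕ Fin g) finAdeleQ))
    (hinj : Function.Injective H)
    (hcard : ∀ i, (latticeOfGL (a : GL (Fin g ⊕ Fin g) finAdeleQ)).toAddSubgroup.relIndex (H i).toAddSubgroup = n)
    (hst : ∀ i b, ∀ v ∈ H i, M b *ᵥ v ∈ H i)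
    (hexh : ∀ L : Submodule ℤ (Fin g ⊕ Fin g → ℚ), latticeOfGL (a : GL (Fin g ⊕ Fin g) finAdeleQ) ≤ L →
      (∀ v ∈ L, ∀ b ∈ 𝔞, M b *ᵥ v ∈ latticeOfGL (a : GL (Fin g ⊕ Fin g) finAdeleQ)) →
      (latticeOfGL (a : GL (Fin g ⊕ Fin g) finAdeleQ)).toAddSubgroup.relIndex L.toAddSubgroup = n →
      (∀ b, ∀ v ∈ L, M b *ᵥ v ∈ L) → ∃ i, H i = L) :
    ∃ Hβ : β → Subgroup (A.Points ℂ),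
      (∀ i P, P ∈ Hβ i ↔ P ∈ m.r '' (H i : Set (Fin g ⊕ Fin g → ℚ))) ∧
      Function.Injective Hβ ∧
      (∀ i, Nat.card ↥(Hβ i) = n ∧ (∀ P ∈ Hβ i, ∀ b ∈ 𝔞, AlgPoints.map (ι b).hom.hom.hom P = 1) ∧
        ∀ b, ∀ P ∈ Hβ i, AlgPoints.map (ι b).hom.hom.hom P ∈ Hβ i) ∧
      ∀ H' : Subgroup (A.Points ℂ), Nat.card ↥H' = n → (∀ P ∈ H', ∀ b ∈ 𝔞, AlgPoints.map (ι b).hom.hom.hom P = 1) →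
        (∀ b, ∀ P ∈ H', AlgPoints.map (ι b).hom.hom.hom P ∈ H') → ∃ i, Hβ i = H' := by
  classical
  -- the subgroups `u(H i)`
  let Hβ : β → Subgroup (A.Points ℂ) := fun i =>
    { carrier := m.r '' (H i : Set (Fin g ⊕ Fin g → ℚ))
      one_mem' := ⟨0, (H i).zero_mem, m.r_zero⟩
      mul_mem' := by
        rintro _ _ ⟨v, hv, rfl⟩ ⟨w, hw, rfl⟩
        exact ⟨v + w, (H i).add_mem hv hw, m.r_add v w⟩
      inv_mem' := by
        rintro _ ⟨v, hv, rfl⟩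
        exact ⟨-v, (H i).neg_mem hv, m.r_neg v⟩ }
  have hHβ : ∀ i P, P ∈ Hβ i ↔ P ∈ m.r '' (H i : Set (Fin g ⊕ Fin g → ℚ)) := fun _ _ => Iff.rfl
  have hcoe : ∀ i, (Hβ i : Set (A.Points ℂ)) = m.r '' (H i : Set (Fin g ⊕ Fin g → ℚ)) := fun _ => rfl
  -- the `𝔞`-torsion lattice `𝔞⁻¹Λ_a`
  let Lmax : Submodule ℤ (Fin g ⊕ Fin g → ℚ) :=
    ⨅ b ∈ 𝔞, (latticeOfGL (a : GL (Fin g ⊕ Fin g) finAdeleQ)).comap ((M b).mulVecLin.restrictScalars ℤ)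
  have hLmax : ∀ v, v ∈ Lmax ↔ ∀ b ∈ 𝔞, M b *ᵥ v ∈ latticeOfGL (a : GL (Fin g ⊕ Fin g) finAdeleQ) := fun v => by
    change v ∈ ⨅ b ∈ 𝔞, (latticeOfGL (a : GL (Fin g ⊕ Fin g) finAdeleQ)).comap ((M b).mulVecLin.restrictScalars ℤ) ↔ _
    simp only [Submodule.mem_iInf, Submodule.mem_comap, LinearMap.restrictScalars_apply, Matrix.mulVecLin_apply]
  have hΛmax : latticeOfGL (a : GL (Fin g ⊕ Fin g) finAdeleQ) ≤ Lmax := fun v hv => (hLmax v).2 fun b _ => by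
    -- `Λ_a` itself is `M b`-stable: `u (M b v) = ι b (u v) = ι b 1 = 1`
    rw [← m.r_eq_one_iff_mem_latticeOfGL, ← hι, (m.r_eq_one_iff_mem_latticeOfGL v).2 hv]
    have h := map_one (IsMonHom.monoidHom (ι b).hom.hom.hom (specOver ℂ ℂ))
    simpa only [IsMonHom.monoidHom_apply, AlgPoints.map_apply] using h
  refine ⟨Hβ, hHβ, fun i j hij => hinj ((m.image_r_eq_image_r_iff (hΛ i) (hΛ j)).1 (by rw [← hcoe, ← hcoe, hij])), fun i => ⟨?_, ?_, ?_⟩,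
    fun H' hH'card hH'tor hH'st => ?_⟩
  · -- order
    rw [← hcard i, ← m.natCard_image_r_eq_relIndex]
    exact Nat.card_congr (Equiv.subtypeEquivRight fun _ => Iff.rfl)
  · -- `𝔞`-torsion
    rintro _ ⟨v, hv, rfl⟩ b hb
    rw [hι, m.r_eq_one_iff_mem_latticeOfGL]
    exact h𝔞 i v hv b hb
  · -- `ι`-stability
    intro b P hP
    exact m.map_mem_image_r_of_forall_mulVec_mem (ι b) (M b) (hι b) (hst i b) hP
  · -- exhaustion
    have hsub : (H' : Set (A.Points ℂ)) ⊆ m.r '' (Lmax : Set (Fin g ⊕ Fin g → ℚ)) := fun P hP => by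
      obtain ⟨v, hv, hvΛ⟩ := (m.forall_map_eq_one_iff_exists_r_eq 𝔞 ι M (fun b _ v => hι b v) hb₀ q₀ hq₀ P).1 (hH'tor P hP)
      exact ⟨v, (hLmax v).2 hvΛ, hv⟩
    obtain ⟨L, hΛL, hLmaxL, hLH⟩ := m.exists_submodule_image_r_eq hΛmax H' hsub
    have hLst : ∀ b, ∀ v ∈ L, M b *ᵥ v ∈ L := fun b =>
      m.forall_mulVec_mem_of_forall_map_mem_image_r hΛL (ι b) (M b) (hι b) fun P hP => by
        rw [hLH] at hP ⊢
        exact hH'st b P hP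
    have hLcard : (latticeOfGL (a : GL (Fin g ⊕ Fin g) finAdeleQ)).toAddSubgroup.relIndex L.toAddSubgroup = n := by
      rw [← m.natCard_image_r_eq_relIndex, ← hH'card]
      exact Nat.card_congr (Equiv.subtypeEquivRight fun P => by rw [hLH]; exact Iff.rfl)
    obtain ⟨i, hi⟩ := hexh L hΛL (fun v hv => (hLmax v).1 (hLmaxL hv)) hLcard hLst
    refine ⟨i, Subgroup.ext fun P => ?_⟩
    rw [hHβ, hi, hLH]
    exact Iff.rfl

/-! ### §4 (ED. 2, add-only) The kernel reader of a line: `u(L) = (⋂_{i ∈ S} Ker h_i) ∩ A[𝔞]` as a membership statement -/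

/-- **`P ∈ u(L) ↔ (∀ i ∈ S, h_i P = 1) ∧ (∀ b ∈ 𝔞, ι b P = 1)`** when `L = {v | (∀ i ∈ S, q_i v ∈ Λ_{a′}) ∧ ∀ b ∈ 𝔞, M b v ∈ Λ_a}` — the reader
`P ∈ H_β ↔ P ∈ K_β ∧ P ∈ A[𝔭̄]` of conjunct (4) of the E-side Hecke roofs (`K_β = ⋂_{π ∈ 𝔭} Ker h_π` for the `𝔭`-family of marked homs `h_π : A ⟶ A′`
reading `q_π`, one of them invertible; ★ `forall_map_eq_one_and_forall_iff`). [cite: Milne2005ShimuraVarieties, §6 Thm. 6.11 p. 74 and p. 75]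
[cite: MumfordAV1970, §7 Thm. 4 (p. 72)] -/
theorem mem_image_r_iff_forall_map_eq_one_and_forall (m : SiegelAdelicMarking J a A)
    {J' : C0pm δ} {a' : gspFinAdelic δ} {A' : AbelianVariety ℂ} (m' : SiegelAdelicMarking J' a' A')
    {R' : Type*} (S : Set R') (h : R' → (A ⟶ A')) (q : R' → Matrix (Fin g ⊕ Fin g) (Fin g ⊕ Fin g) ℚ)
    (hh : ∀ i ∈ S, ∀ v : Fin g ⊕ Fin g → ℚ, AlgPoints.map (h i).hom.hom.hom (m.r v) = m'.r (q i *ᵥ v))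
    {i₀ : R'} (hi₀ : i₀ ∈ S) (q₀ : GL (Fin g ⊕ Fin g) ℚ)
    (hq₀ : ((q₀ : GL (Fin g ⊕ Fin g) ℚ) : Matrix (Fin g ⊕ Fin g) (Fin g ⊕ Fin g) ℚ) = q i₀)
    {R : Type*} (𝔞 : Set R) (ι : R → (A ⟶ A)) (M : R → Matrix (Fin g ⊕ Fin g) (Fin g ⊕ Fin g) ℚ)
    (hι : ∀ b ∈ 𝔞, ∀ v : Fin g ⊕ Fin g → ℚ, AlgPoints.map (ι b).hom.hom.hom (m.r v) = m.r (M b *ᵥ v))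
    {L : Submodule ℤ (Fin g ⊕ Fin g → ℚ)}
    (hL : ∀ v, v ∈ L ↔ (∀ i ∈ S, q i *ᵥ v ∈ latticeOfGL (a' : GL (Fin g ⊕ Fin g) finAdeleQ)) ∧
      ∀ b ∈ 𝔞, M b *ᵥ v ∈ latticeOfGL (a : GL (Fin g ⊕ Fin g) finAdeleQ))
    (P : A.Points ℂ) :
    P ∈ m.r '' (L : Set (Fin g ⊕ Fin g → ℚ)) ↔
      (∀ i ∈ S, AlgPoints.map (h i).hom.hom.hom P = 1) ∧ ∀ b ∈ 𝔞, AlgPoints.map (ι b).hom.hom.hom P = 1 := by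
  rw [m.forall_map_eq_one_and_forall_iff m' S h q hh hi₀ q₀ hq₀ 𝔞 ι M hι P]
  constructor
  · rintro ⟨v, hv, rfl⟩
    exact ⟨v, rfl, ((hL v).1 hv).1, ((hL v).1 hv).2⟩
  · rintro ⟨v, hv, h1, h2⟩
    exact ⟨v, (hL v).2 ⟨h1, h2⟩, hv⟩

/-- **The joint kernel `⋂_{i ∈ S} Ker h_i (ℂ)` of a family of homomorphisms `A ⟶ A′` is a subgroup of `A(ℂ)`** (existence with its reader; the `K_β` of
conjunct (4) of the E-side Hecke roofs). [cite: MumfordAV1970, §7 Thm. 4 (p. 72)] -/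
theorem exists_subgroup_forall_map_eq_one {A' : AbelianVariety ℂ} {R' : Type*} (S : Set R') (h : R' → (A ⟶ A')) :
    ∃ K : Subgroup (A.Points ℂ), ∀ P, P ∈ K ↔ ∀ i ∈ S, AlgPoints.map (h i).hom.hom.hom P = 1 := by
  have h1 : ∀ i, AlgPoints.map (h i).hom.hom.hom (1 : A.Points ℂ) = 1 := fun i => by
    have hm := map_one (IsMonHom.monoidHom (h i).hom.hom.hom (specOver ℂ ℂ))
    simpa only [IsMonHom.monoidHom_apply, AlgPoints.map_apply] using hm
  have hmul : ∀ i (P Q : A.Points ℂ), AlgPoints.map (h i).hom.hom.hom (P * Q) =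
      AlgPoints.map (h i).hom.hom.hom P * AlgPoints.map (h i).hom.hom.hom Q := fun i P Q => by
    have hm := map_mul (IsMonHom.monoidHom (h i).hom.hom.hom (specOver ℂ ℂ)) P Q
    simpa only [IsMonHom.monoidHom_apply, AlgPoints.map_apply] using hm
  have hinv : ∀ i (P : A.Points ℂ), AlgPoints.map (h i).hom.hom.hom P⁻¹ = (AlgPoints.map (h i).hom.hom.hom P)⁻¹ := fun i P => by
    have hm := map_inv (IsMonHom.monoidHom (h i).hom.hom.hom (specOver ℂ ℂ)) P
    simpa only [IsMonHom.monoidHom_apply, AlgPoints.map_apply] using hm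
  let K : Subgroup (A.Points ℂ) :=
    { carrier := {P | ∀ i ∈ S, AlgPoints.map (h i).hom.hom.hom P = 1},
      one_mem' := fun i _ => h1 i,
      mul_mem' := fun {P Q} hP hQ i hi => by rw [hmul, hP i hi, hQ i hi, mul_one],
      inv_mem' := fun {P} hP i hi => by rw [hinv, hP i hi, inv_one] }
  exact ⟨K, fun P => Iff.rfl⟩

end SiegelAdelicMarking

end Literature.AlgebraicGeometry.ModuliOfAbelianVarieties

end
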